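import Literature.Computability.Complexity.ExtMonotoneCliqueGate
import Literature.Computability.Complexity.CircuitLowerBoundsProofs
import Mathlib.Algebra.Group.End

/-!
# PneNP / ConvexRankGates — crux `LinAlgGateBlind` (stmt-PneNP-10681), negative side:
# ONE permutation gate computes CLIQUE (the `A–B` connectivity gadget)

Negative-side support (standing disprover, `Cruxes/LinAlgGateBlind/Disproof.lean`). PERM gates
(`IsPermGate s`, `ExtMonotoneGates.lean`: fixed permutations `σᵢ, τ` of `≤ s` points, accept `v`
iff `τ ∈ ⟨σᵢ : vᵢ = 1⟩`) are the group-membership door of the crux `LinAlgGateBlind`. Here we prove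
that the POINT BOUND `d ≤ m^c` is load-bearing: for every `m` and `k ≥ 2` ONE permutation gate on
`2 + C(m,k)·(#E(K_m) - 1)` points computes `CLIQUE(m,k)` exactly
(`exists_onePermGate_computes_cliqueFn`, `card_Pt`, `card_Pt_le : ≤ m^{k+3}`).

Construction: points `A`, `B` and, for every `k`-set `T`, a private path `A = n₀ — n₁ — ⋯ — n_N = B`
of length `N = #E(K_m)`; position `j` of the path carries the transposition `(n_j n_{j+1})` and reads
the `j`-th edge inside `T` (positions beyond `C(k,2)` re-read edge `0`); target `τ = (A B)`.
If `T` is a clique all its transpositions are on and generate `(A B)` (`swap_A_node_mem`, by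
`(n_j n_{j+1})(A n_j)(n_j n_{j+1}) = (A n_{j+1})`); conversely the set `S` of `A` and the private nodes
reachable along an all-on prefix is preserved by every switched-on transposition unless some path is
entirely on, and `(A B) ∉ Stab(S)` since `B ∉ S` (`swap_AB_mem_closure_iff`, `setStab`). The gate on
`Fin d` is obtained by transport along `Fintype.equivFin` (`isPermGate_of_fintype`).
-/

namespace Summit.PneNP.PneNP.Theorems.LinAlgGateBlind.Negative

open Literature.Computability.Complexity

section PermGadget

open Equiv

/-- PERM gates presented on an arbitrary finite point type transport to `IsPermGate`. [folklore] -/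
theorem isPermGate_of_fintype {P : Type} [Fintype P] [DecidableEq P] {s n : ℕ}
    (hs : Fintype.card P ≤ s) (σ : Fin n → Perm P) (τ : Perm P) (f : (Fin n → Bool) → Bool)
    (hf : ∀ v, f v = true ↔ τ ∈ Subgroup.closure (σ '' {i | v i = true})) :
    IsPermGate s ⟨n, f⟩ := by
  let e := Fintype.equivFin P
  let φ : Perm P ≃* Perm (Fin (Fintype.card P)) := e.permCongrHom
  refine ⟨Fintype.card P, hs, fun i => φ (σ i), φ τ, fun v => ?_⟩
  show f v = true ↔ _
  have himg : (fun i => φ (σ i)) '' {i | v i = true} = φ.toMonoidHom '' (σ '' {i | v i = true}) := by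
    rw [Set.image_image]; rfl
  rw [hf v, himg, ← MonoidHom.map_closure, Subgroup.mem_map_equiv, MulEquiv.symm_apply_apply]

/-- The subgroup of permutations preserving a set (both ways). [folklore] -/
def setStab {P : Type*} (S : Set P) : Subgroup (Perm P) where
  carrier := {g | ∀ p, g p ∈ S ↔ p ∈ S}
  mul_mem' {g h} hg hh p := by rw [Perm.mul_apply, hg, hh]
  one_mem' p := by simp
  inv_mem' {g} hg p := by
    have := hg (g⁻¹ p)
    have h1 : g (g⁻¹ p) = p := Equiv.apply_symm_apply g p
    rw [h1] at this
    exact this.symm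

/-- `swap_mem_setStab` (connectivity gadget bookkeeping). [folklore] -/
theorem swap_mem_setStab {P : Type*} [DecidableEq P] {S : Set P} {u v : P} (h : u ∈ S ↔ v ∈ S) :
    swap u v ∈ setStab S := by
  intro p
  by_cases hu : p = u
  · subst hu; rw [swap_apply_left]; exact h.symm
  by_cases hv : p = v
  · subst hv; rw [swap_apply_right]; exact h
  rw [swap_apply_of_ne_of_ne hu hv]

variable (m k : ℕ)

/-- The `k`-subsets of `Fin m`. [folklore] -/
abbrev KS : Type := CliqueLPGate.KSub m k

/-- Uniform path length `N₀ = #E(K_m)` (positions beyond the live edges of `T` re-read edge `0`). [folklore] -/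
noncomputable abbrev N₀ : ℕ := CliqueLPGate.nE m

/-- Points of the gadget: `A = inl false`, `B = inl true`, and private path nodes `(T, i)`,
`i < N₀ - 1` (standing for node `i + 1` of the path of `T`). [folklore] -/
abbrev Pt : Type := Bool ⊕ (KS m k × Fin (N₀ m - 1))

variable {m k}

/-- Node `i` of the path of `T`: `A` for `i = 0`, private for `0 < i < N₀`, `B` for `i ≥ N₀`. [folklore] -/
noncomputable def node (T : KS m k) (i : ℕ) : Pt m k :=
  if h0 : i = 0 then Sum.inl false
  else if h : i < N₀ m then Sum.inr (T, ⟨i - 1, by omega⟩) else Sum.inl true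

/-- `node_zero` (connectivity gadget bookkeeping). [folklore] -/
theorem node_zero (T : KS m k) : node T 0 = Sum.inl false := by simp [node]

/-- `node_N₀` (connectivity gadget bookkeeping). [folklore] -/
theorem node_N₀ (T : KS m k) {i : ℕ} (hi : N₀ m ≤ i) (h0 : i ≠ 0) : node T i = Sum.inl true := by
  simp [node, h0, not_lt.2 hi]

/-- `node_mid` (connectivity gadget bookkeeping). [folklore] -/
theorem node_mid (T : KS m k) {i : ℕ} (h0 : 0 < i) (hi : i < N₀ m) :
    node T i = Sum.inr (T, ⟨i - 1, by omega⟩) := by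
  simp [node, Nat.pos_iff_ne_zero.1 h0, hi]

/-- `node_ne_A` (connectivity gadget bookkeeping). [folklore] -/
theorem node_ne_A (T : KS m k) {i : ℕ} (h0 : 0 < i) : node T i ≠ Sum.inl false := by
  by_cases hi : i < N₀ m
  · rw [node_mid T h0 hi]; simp
  · rw [node_N₀ T (not_lt.1 hi) (by omega)]; simp

/-- `node_eq_inr_iff` (connectivity gadget bookkeeping). [folklore] -/
theorem node_eq_inr_iff (T T' : KS m k) {i : ℕ} (h0 : 0 < i) (j : Fin (N₀ m - 1)) :
    node T i = Sum.inr (T', j) ↔ T = T' ∧ i = j + 1 := by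
  by_cases hi : i < N₀ m
  · rw [node_mid T h0 hi, Sum.inr.injEq, Prod.mk.injEq]
    constructor
    · rintro ⟨rfl, h⟩
      refine ⟨rfl, ?_⟩
      have := congrArg Fin.val h
      simp at this
      omega
    · rintro ⟨rfl, h⟩
      refine ⟨rfl, Fin.ext ?_⟩
      simp; omega
  · rw [node_N₀ T (not_lt.1 hi) (by omega)]
    simp only [reduceCtorEq, false_iff, not_and]
    rintro rfl
    have := j.isLt
    omega

/-- The live edges of the vertex set `T` (both endpoints in `T`). [folklore] -/
noncomputable def liveEdges (T : Finset (Fin m)) : Finset (⊤ : SimpleGraph (Fin m)).edgeSet :=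
  Finset.univ.filter fun e => IsLive T e

/-- `mem_liveEdges` (connectivity gadget bookkeeping). [folklore] -/
theorem mem_liveEdges {T : Finset (Fin m)} {e : (⊤ : SimpleGraph (Fin m)).edgeSet} :
    e ∈ liveEdges T ↔ IsLive T e := by simp [liveEdges]

/-- `liveEdges_nonempty` (connectivity gadget bookkeeping). [folklore] -/
theorem liveEdges_nonempty (hk : 2 ≤ k) (T : KS m k) : 0 < (liveEdges T.1).card := by
  obtain ⟨u, hu, v, hv, huv⟩ := Finset.one_lt_card.1 (by have := T.2; omega : 1 < T.1.card)
  have he : s(u, v) ∈ (⊤ : SimpleGraph (Fin m)).edgeSet := (SimpleGraph.mem_edgeSet _).2 huv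
  exact Finset.card_pos.2 ⟨⟨s(u, v), he⟩, mem_liveEdges.2 ((isLive_mk he).2 ⟨hu, hv⟩)⟩

/-- `card_liveEdges_le` (connectivity gadget bookkeeping). [folklore] -/
theorem card_liveEdges_le (T : Finset (Fin m)) : (liveEdges T).card ≤ N₀ m :=
  (Finset.card_filter_le _ _).trans (by simp [CliqueLPGate.nE])

/-- The edge read at position `j < N₀` of the path of `T`: the `j`-th live edge, or live edge `0`. [folklore] -/
noncomputable def edgeAt (hk : 2 ≤ k) (T : KS m k) (j : ℕ) : (⊤ : SimpleGraph (Fin m)).edgeSet :=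
  ((liveEdges T.1).equivFin.symm
    (if h : j < (liveEdges T.1).card then ⟨j, h⟩ else ⟨0, liveEdges_nonempty hk T⟩) : liveEdges T.1)

/-- `isLive_edgeAt` (connectivity gadget bookkeeping). [folklore] -/
theorem isLive_edgeAt (hk : 2 ≤ k) (T : KS m k) (j : ℕ) : IsLive T.1 (edgeAt hk T j) :=
  mem_liveEdges.1 ((liveEdges T.1).equivFin.symm _).2

/-- All positions of the path of `T` are on iff all live edges of `T` are on (iff `T` is a clique). [folklore] -/
theorem forall_edgeAt_iff (hk : 2 ≤ k) (T : KS m k) (x : (⊤ : SimpleGraph (Fin m)).edgeSet → Bool) :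
    (∀ j < N₀ m, x (edgeAt hk T j) = true) ↔ ∀ e, IsLive T.1 e → x e = true := by
  constructor
  · intro h e he
    set j := (liveEdges T.1).equivFin ⟨e, mem_liveEdges.2 he⟩ with hj
    have hjlt : (j : ℕ) < (liveEdges T.1).card := j.isLt
    have := h j (lt_of_lt_of_le hjlt (card_liveEdges_le T.1))
    rw [edgeAt, dif_pos hjlt, Fin.eta, hj, Equiv.symm_apply_apply] at this
    exact this
  · intro h j _
    exact h _ (isLive_edgeAt hk T j)

/-- Generator at position `j`: the transposition of nodes `j` and `j + 1` of the path of `T`. [folklore] -/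
noncomputable def gen (T : KS m k) (j : ℕ) : Perm (Pt m k) := swap (node T j) (node T (j + 1))

/-- Going up the path: if all positions `< i` of `T` are on then `swap A (node T i)` is generated
(`1 ≤ i ≤ N₀`). [folklore] -/
theorem swap_A_node_mem {H : Subgroup (Perm (Pt m k))} (T : KS m k) {i : ℕ} (h1 : 1 ≤ i)
    (hgen : ∀ j < i, gen T j ∈ H) : swap (Sum.inl false) (node T i) ∈ H := by
  induction i with
  | zero => omega
  | succ i ih =>
    rcases Nat.eq_zero_or_pos i with rfl | hi
    · have := hgen 0 (by omega)
      rwa [gen, node_zero] at this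
    · have hprev := ih hi fun j hj => hgen j (by omega)
      have hg := hgen i (by omega)
      rw [gen] at hg
      have key := swap_mul_swap_mul_swap (x := (Sum.inl false : Pt m k)) (y := node T i)
        (z := node T (i + 1)) (node_ne_A T hi).symm (node_ne_A T (by omega)).symm
      rw [swap_comm (node T (i + 1))] at key
      rw [← key]
      exact H.mul_mem (H.mul_mem hg hprev) hg

variable (hk : 2 ≤ k)

/-- **The connectivity gadget is exact**: `swap A B` lies in the subgroup generated by the switched-on
path transpositions iff some `k`-set has all its positions on. [folklore] -/
theorem swap_AB_mem_closure_iff (x : (⊤ : SimpleGraph (Fin m)).edgeSet → Bool) :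
    swap (Sum.inl false) (Sum.inl true) ∈ Subgroup.closure
        {g | ∃ (T : KS m k) (j : ℕ), j < N₀ m ∧ x (edgeAt hk T j) = true ∧ g = gen T j} ↔
      ∃ T : KS m k, ∀ j < N₀ m, x (edgeAt hk T j) = true := by
  constructor
  · intro hmem
    by_contra hno
    push Not at hno
    -- the invariant set: `A` and the private nodes reachable along an all-on prefix
    let S : Set (Pt m k) := {p | p = Sum.inl false ∨ ∃ (T : KS m k) (i : ℕ), 0 < i ∧ i < N₀ m ∧
      p = node T i ∧ ∀ j < i, x (edgeAt hk T j) = true}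
    have hB : (Sum.inl true : Pt m k) ∉ S := by
      rintro (h | ⟨T, i, h0, hi, h, -⟩)
      · simp at h
      · rw [node_mid T h0 hi] at h; simp at h
    have hA : (Sum.inl false : Pt m k) ∈ S := Or.inl rfl
    -- membership of private nodes in `S`
    have hmemS : ∀ (T : KS m k) (i : ℕ), 0 < i → (node T i ∈ S ↔
        i < N₀ m ∧ ∀ j < i, x (edgeAt hk T j) = true) := by
      intro T i h0
      constructor
      · rintro (h | ⟨T', i', h0', hi', h, hall⟩)
        · exact absurd h (node_ne_A T h0)
        · rw [node_mid T' h0' hi', node_eq_inr_iff T T' h0] at h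
          obtain ⟨rfl, hi⟩ := h
          have : i = i' := by simp at hi; omega
          subst this
          exact ⟨hi', hall⟩
      · rintro ⟨hi, hall⟩
        exact Or.inr ⟨T, i, h0, hi, rfl, hall⟩
    -- every switched-on generator preserves `S`
    have hgen : ∀ g ∈ {g | ∃ (T : KS m k) (j : ℕ), j < N₀ m ∧ x (edgeAt hk T j) = true ∧ g = gen T j},
        g ∈ setStab S := by
      rintro g ⟨T, j, hj, hxj, rfl⟩
      apply swap_mem_setStab
      constructor
      · intro hjS
        -- all positions `< j` are on (trivial for `j = 0`), and position `j` is on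
        have hall : ∀ j' < j + 1, x (edgeAt hk T j') = true := by
          intro j' hj'
          rcases Nat.lt_succ_iff_lt_or_eq.1 hj' with hlt | rfl
          · rcases Nat.eq_zero_or_pos j with rfl | h0
            · omega
            · exact ((hmemS T j h0).1 hjS).2 j' hlt
          · exact hxj
        by_cases hj1 : j + 1 < N₀ m
        · exact (hmemS T (j + 1) (by omega)).2 ⟨hj1, hall⟩
        · obtain ⟨j', hj', hne⟩ := hno T
          exact absurd (hall j' (by omega)) hne
      · intro hj1S
        obtain ⟨hj1, hall⟩ := (hmemS T (j + 1) (by omega)).1 hj1S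
        rcases Nat.eq_zero_or_pos j with rfl | h0
        · rw [node_zero]; exact hA
        · exact (hmemS T j h0).2 ⟨by omega, fun j' hj' => hall j' (by omega)⟩
    have hle := (Subgroup.closure_le (setStab S)).2 hgen
    have := (hle hmem) (Sum.inl false)
    rw [swap_apply_left] at this
    exact hB (this.2 hA)
  · rintro ⟨T, hT⟩
    have hN : 1 ≤ N₀ m := (liveEdges_nonempty hk T).trans_le (card_liveEdges_le T.1)
    have h := swap_A_node_mem (H := Subgroup.closure
      {g | ∃ (T : KS m k) (j : ℕ), j < N₀ m ∧ x (edgeAt hk T j) = true ∧ g = gen T j}) T hN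
      (fun j hj => Subgroup.subset_closure ⟨T, j, hj, hT j hj, rfl⟩)
    rwa [node_N₀ T le_rfl (by omega)] at h


/-- `CLIQUE(m,k)(x) = 1` iff some `k`-set has all the positions of its path on. [folklore] -/
theorem cliqueFn_eq_true_iff_exists_edgeAt (x : (⊤ : SimpleGraph (Fin m)).edgeSet → Bool) :
    cliqueFn m k x = true ↔ ∃ T : KS m k, ∀ j < N₀ m, x (edgeAt hk T j) = true := by
  rw [cliqueFn_eq_true_iff_exists]
  constructor
  · rintro ⟨T, hT, hx⟩
    exact ⟨⟨T, hT⟩, (forall_edgeAt_iff hk ⟨T, hT⟩ x).2 hx⟩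
  · rintro ⟨T, hT⟩
    exact ⟨T.1, T.2, (forall_edgeAt_iff hk T x).1 hT⟩

variable (m k)

/-- The argument positions of the gadget gate: (`k`-set, path position). [folklore] -/
abbrev Arg : Type := KS m k × Fin (N₀ m)

variable {m k}

/-- The generator attached to argument position `a = (T, j)`. [folklore] -/
noncomputable def genAt (a : Fin (Fintype.card (Arg m k))) : Perm (Pt m k) :=
  gen ((Fintype.equivFin (Arg m k)).symm a).1 ((Fintype.equivFin (Arg m k)).symm a).2

open scoped Classical in
/-- The gadget as a gate function on `Fin #Arg` inputs. [folklore] -/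
noncomputable def permCliqueGate : GateFn :=
  ⟨Fintype.card (Arg m k), fun v => decide (swap (Sum.inl false) (Sum.inl true) ∈
    Subgroup.closure (genAt (m := m) (k := k) '' {a | v a = true}))⟩

/-- The wiring of the gadget gate: position `a = (T, j)` reads `edgeAt T j`. [folklore] -/
noncomputable def permCliqueWire (a : Fin (Fintype.card (Arg m k))) : (⊤ : SimpleGraph (Fin m)).edgeSet :=
  edgeAt hk ((Fintype.equivFin (Arg m k)).symm a).1 ((Fintype.equivFin (Arg m k)).symm a).2

/-- `permCliqueGate_isPermGate` (connectivity gadget bookkeeping). [folklore] -/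
theorem permCliqueGate_isPermGate : IsPermGate (Fintype.card (Pt m k)) (permCliqueGate (m := m) (k := k)) := by
  classical
  exact isPermGate_of_fintype le_rfl _ _ _ fun _ => decide_eq_true_iff

/-- The switched-on generators of the wired gate are the switched-on path transpositions. [folklore] -/
theorem image_genAt_eq (x : (⊤ : SimpleGraph (Fin m)).edgeSet → Bool) :
    genAt (m := m) (k := k) '' {a | x (permCliqueWire hk a) = true} =
      {g | ∃ (T : KS m k) (j : ℕ), j < N₀ m ∧ x (edgeAt hk T j) = true ∧ g = gen T j} := by
  ext g
  simp only [Set.mem_image, Set.mem_setOf_eq, permCliqueWire, genAt]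
  constructor
  · rintro ⟨a, ha, rfl⟩
    exact ⟨_, _, ((Fintype.equivFin (Arg m k)).symm a).2.isLt, ha, rfl⟩
  · rintro ⟨T, j, hj, hx, rfl⟩
    refine ⟨Fintype.equivFin (Arg m k) (T, ⟨j, hj⟩), ?_, ?_⟩ <;> simp [hx]

/-- **The gadget gate, wired to the edges, computes `CLIQUE(m, k)`** (`k ≥ 2`). [folklore] -/
theorem permCliqueGate_apply (x : (⊤ : SimpleGraph (Fin m)).edgeSet → Bool) :
    (permCliqueGate (m := m) (k := k)).2 (fun a => x (permCliqueWire hk a)) = cliqueFn m k x := by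
  classical
  apply Bool.eq_iff_iff.2
  rw [cliqueFn_eq_true_iff_exists_edgeAt hk, ← swap_AB_mem_closure_iff hk x, ← image_genAt_eq hk x]
  exact decide_eq_true_iff

variable (m k) in
/-- **`CLIQUE(m, k)` is ONE PERM gate on `#Pt = 2 + C(m,k)·(#E(K_m) - 1)` points** (`k ≥ 2`). [folklore] -/
theorem exists_onePermGate_computes_cliqueFn (hk : 2 ≤ k) :
    ∃ C : Circuit ((⊤ : SimpleGraph (Fin m)).edgeSet),
      C.IsOver {g | IsPermGate (Fintype.card (Pt m k)) g} ∧ C.size ≤ 1 ∧ C.Computes (cliqueFn m k) := by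
  obtain ⟨C, hC, hs, he⟩ := (CktSize.gate (B := {g | IsPermGate (Fintype.card (Pt m k)) g})
    permCliqueGate permCliqueGate_isPermGate (permCliqueWire hk)).toCircuit
  exact ⟨C, hC, hs, fun x => by rw [he x]; exact permCliqueGate_apply hk x⟩

variable (m k) in
/-- Point count of the gadget. [folklore] -/
theorem card_Pt : Fintype.card (Pt m k) = 2 + m.choose k * (CliqueLPGate.nE m - 1) := by
  simp only [Pt, Fintype.card_sum, Fintype.card_bool, Fintype.card_prod, Fintype.card_fin]
  rw [show Fintype.card (KS m k) = m.choose k from CliqueLPGate.nK_eq m k]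

variable (m k) in
/-- The gadget has at most `m^{k+3}` points (`m ≥ 2`): one-gate point threshold. [folklore] -/
theorem card_Pt_le (hm : 2 ≤ m) : Fintype.card (Pt m k) ≤ m ^ (k + 3) := by
  rw [card_Pt]
  have : 2 + m.choose k * (CliqueLPGate.nE m - 1) ≤ 1 + (1 + m.choose k * CliqueLPGate.nE m) := by
    have := Nat.mul_le_mul_left (m.choose k) (Nat.sub_le (CliqueLPGate.nE m) 1)
    omega
  refine this.trans ?_
  have h2 : 1 + (1 + m.choose k * CliqueLPGate.nE m) ≤ m ^ (k + 2) + m ^ (k + 2) := by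
    have : 1 ≤ m ^ (k + 2) := Nat.one_le_pow _ _ (by omega)
    have : m.choose k * CliqueLPGate.nE m ≤ m ^ k * m ^ 2 :=
      Nat.mul_le_mul (Nat.choose_le_pow m k) (CliqueLPGate.nE_le m)
    have : m ^ k * m ^ 2 = m ^ (k + 2) := by ring
    have : 2 ≤ m ^ (k + 2) := le_trans hm (by
      calc m = m ^ 1 := (pow_one m).symm
        _ ≤ m ^ (k + 2) := Nat.pow_le_pow_right (by omega) (by omega))
    omega
  calc 1 + (1 + m.choose k * CliqueLPGate.nE m) ≤ m ^ (k + 2) + m ^ (k + 2) := h2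
    _ = 2 * m ^ (k + 2) := by ring
    _ ≤ m * m ^ (k + 2) := Nat.mul_le_mul_right _ hm
    _ = m ^ (k + 3) := by ring

end PermGadget

end Summit.PneNP.PneNP.Theorems.LinAlgGateBlind.Negative
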